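import Summits.MatrixMultiplication.MatrixMultiplication.Theses.CubicExchangeSplit
import Summits.MatrixMultiplication.MatrixMultiplication.Theorems.CubicAmortisation.Negative.LoadBearing
import Literature.Computability.AlgebraicComplexity.AsymptoticRankMultiplesMatMul
import Literature.Computability.AlgebraicComplexity.GroupTheoreticMatMulProofs
import Literature.Computability.AlgebraicComplexity.LocalStrongUSP

/-!
# Line `skew-usp` for crux `CubicAmortisation` (E₃ : ω(1,1,3) = 4) — stmt-MatrixMultiplication-18000

Strategist line (crux-strategist r1, `planner-cstrat-stmt-MatrixMultiplication-18000-r1-0`, 2026-08-17); the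
registered skeleton `Lines/birth.lean` (dual localisation, stubs `stub_farFromFace` / `stub_nearFace`) is untouched.

THE LINE (primal, group-theoretic; the engine the first strategy census did not consider).  Cohn–Kleinberg–
Szegedy–Umans 2005, Thm. 33 (PROVED in the tree: `CohnKleinbergSzegedyUmans2005_thm33_holds`) turns a local strong
USP `U ⊆ {0,1,2}^{5m}` all of whose rows lie in the SKEW CLASS `(m, m, 3m)` (m zeros, m ones, 3m twos) into an
STPP family in `Cyc₅^{5m}` of `|U|` blocks `⟨4^m, 4^m, 4^{3m}⟩ = ⟨n, n, n³⟩`, `n = 4^m` (`card_uspA/B/C`,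
Theorems/ThinBlockAlphaUSPToBounded.lean).  CKSU Thm. 5.3 (`tensorRank_matMulDirectSum_le_card_of_isSTPP`), block
extraction (`tensorRank_multiple_le_kroneckerPow_matMulDirectSum`) and the rectangular asymptotic sum inequality
(`advxxz2025_thm32`) certify `|U| · n^{ω(1,1,3)} ≤ 5^{5m}`, i.e.

    ω(1,1,3) ≤ (5/2)·log₂ 5 − (5/2)·log₂ σ,   σ := |U|^{1/(5m)}  (rate per column).

TANGENCY (why ℓ = 5 and the class (1,1,3)/5 are forced, and why the target is EXACTLY the counting cap): the
unique-pieces bound (CKSU Lemma 3.2; tree `SkewLocalStrongUSP.Negative.oneSet_injOn`-type counting) caps the rate of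
the class `(c, c, 1−2c)` at `h(c)` bits, while `ω(1,1,(1−2c)/c) = (1−2c)/c + 1` needs `log₂ ℓ − (1−c)·log₂(ℓ−1)` bits;
`h(c) ≥ log₂ ℓ − (1−c) log₂(ℓ−1)` holds ONLY at `c = 1/ℓ`, where the two curves are tangent
(`h'(1/ℓ) = log₂(ℓ−1)`, `h(1/ℓ) = log₂ ℓ − ((ℓ−1)/ℓ) log₂(ℓ−1)`).  Shape `(1,1,3)` means `(1−2c)/c = 3`, `c = 1/5`,
`ℓ = 5`: E₃ ⟸ "skew-(1,1,3) local strong USPs reach the cap `C(5m,m) = 2^{5m·h(1/5) − o(m)}`", rate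
`σ → 2^{h(1/5)} = 1.6494`.  DIAL: σ > 2^{(log₂5 − 2)} = 1.2500 beats the trivial ω(1,1,3) ≤ 5; σ > 1.5610 beats the
laser-method record 4.198809 (VXXZ 2024 Table 1, tree `vxxz2024_omegaRect_table`); σ = 1.6494 is E₃.  RUNGS IN HAND (planner's computation, folder
tmp/usp/skew113.py): CKSU Prop. 11 ∩ class — `{u ∈ {0,2}^{5t} × {1,2}^{5t} : u_i = 0 ↔ u_{5t+i} = 1, #0 = 2t}` IS a
local strong USP (checked at t = 1: 10 rows, width 10, σ = 10^{1/10} = 1.2589 ⇒ ω(1,1,3) ≤ 4.974, a `decide`-size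
instance; asymptotically σ → 2^{h(2/5)/2} = 1.4000 ⇒ 4.591); CKSU Prop. 18 (triangle) re-weighted to the class:
σ → 2^{0.519} ⇒ 4.507 (strong, needs CKSU Prop. 6.3 localisation); exact maximum at m = 1 is 2 (cap 5).  The sibling
crux `ThinBlockAlpha.SkewLocalStrongUSP` (stmt-10598, class (3k,k,3k), ℓ = 7, thin blocks) owns the construction
ENGINE, which is class-agnostic and LANDED: tilted alphabets + constant-composition codes
(`Theorems/ThinBlockAlphaSkewLocalStrongUSPStubConcatWitness.lean`, p86070; there it moved the rate from 67% to 86%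
of log-cap; here 89% of log-cap = the rectangular record).

STUBS (3; the only `sorry`s of the file):
* `stub_skewUSP` — OPEN, load-bearing, C⁺ (= `QuinticSkewUSP`): skew-(1,1,3) local strong USPs at the cap.
* `stub_uspToDesigns` — PROVABLE NOW (M): `QuinticSkewUSP → CubicDesigns` (Thm 33 at ℓ = 5, `card_uspA/B/C`,
  binomial mode `5^{5m} = Σ_j C(5m,j) 4^{5m−j} ≤ (5m+1)·C(5m,m)·4^{4m}`, growth `(5m+1)·2^{δm} ≤ 4^{ηm}`; template:
  `uspToBounded_proof`, Theorems/ThinBlockAlphaUSPToBounded.lean).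
* `stub_designsCertify` — PROVABLE NOW (M): `CubicDesigns → ω(1,1,3) ≤ 4` (CKSU 5.3 + extraction + `advxxz2025_thm32`
  at (a,b,c) = (1,1,3), q = n ≥ 2, t = L; `asymptoticRank_le_tensorRank_pow_one`; compare exponents at base n ≥ 2,
  `η → 0`).  `CubicDesigns` is verbatim the typed statement of `Ideas/cubic-designs.md` (strategist s1).
COMPOSITION (sorry-free): `rankBound_of_stubs` = the dictionary `ω(1,1,3) ≤ 4 ⟹ crux`
(`rankBound_of_omegaRect_le`, re-proved here from `Lines/birth.lean`, uses `0 < ε` — honouring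
`cubicAmortisation_false_without_pos` of the Negative lane) after `h₃ (h₂ h₁)`; `CubicAmortisation_of` concludes the
crux BY NAME from the three stubs.

DISPROOF USED: no `Disproof.lean` is registered for this crux (`ledger crux ls`, 2026-08-17).  Negative lane
`Theorems/CubicAmortisation/Negative/LoadBearing.lean` (imported): `0 < ε` is used (dictionary), no stub instantiates
`ε ≥ 1` (`cubicAmortisation_iff_unit_interval`) or an exponent `< 4` (`not_isBigO_rank_cubic_of_lt_four`).  The sibling's
`Cruxes/SkewLocalStrongUSP/Disproof.lean` (read): its §3 (exact cap refuted mod Füredi) is why C⁺ carries the slack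
`2^{δm}`; its §4 (slice rank / tricolored-sum-free paradigm silent in the skew class) transfers: here the direct Thm 3.3
extraction needs `ε₅ > 0.3445`, the optimal symmetrised one `ε₅ > 0.1149`, and Thm 4.14 at `p = 5` gives `ε₅ = 0.0708`
(cap `4.4616^{n}`); a local strong USP is also directly a tricolored sum-free set in `F₂^{5m}`, capped at `(3/2^{2/3})^{5m} =
2^{0.918·5m} > C(5m,m)`, and slice rank restricted to the weight slices `(m,m,3m)` returns exactly `C(5m,m)` — silent.  Negatives index (12 entries, 2026-08-17): none is a USP / capacity /
cubic-design statement.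
-/

set_option linter.dupNamespace false

noncomputable section

namespace Summit.MatrixMultiplication.MatrixMultiplication.Cruxes.CubicAmortisation.SkewUSP

open Finset Filter Asymptotics
open Summit.MatrixMultiplication.MatrixMultiplication.Theses.CubicExchangeSplit
open Summit.MatrixMultiplication.MatrixMultiplication.Theorems.CubicAmortisation.Negative
open Literature.Computability.AlgebraicComplexity

/-! ## The two intermediate statements -/

/-- **C⁺ = `QuinticSkewUSP`** — skew-class `(1,1,3)` local strong USPs at the unique-pieces cap: for every
`δ > 0` and infinitely many `m`, a family `U ⊆ {0,1,2}^{5m}` of rows with exactly `m` zeros and `m` ones (hence `3m`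
twos), every ordered triple of rows not all equal having a coordinate with one of CKSU's six local-strong-USP
patterns (`localStrongUSPPatterns`: exactly two of `u_i = 0, v_i = 1, w_i = 2`), and `C(5m, m) ≤ 2^{δm}·|U|`.
Same shape as the sibling crux `ThinBlockAlpha.SkewLocalStrongUSP` (class `(3k,k,3k)`, width `7k`). -/
def QuinticSkewUSP : Prop :=
  ∀ δ : ℝ, 0 < δ → ∀ m₀ : ℕ, ∃ m : ℕ, m₀ ≤ m ∧
    ∃ U : Finset (Fin (5 * m) → Fin 3),
      (∀ u ∈ U, ∀ v ∈ U, ∀ w ∈ U, (u ≠ v ∨ v ≠ w) →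
        ∃ i, (u i, v i, w i) ∈ localStrongUSPPatterns) ∧
      (∀ u ∈ U, (univ.filter fun i => u i = 0).card = m ∧ (univ.filter fun i => u i = 1).card = m) ∧
      ((5 * m).choose m : ℝ) ≤ (2 : ℝ) ^ (δ * m) * U.card

/-- **`CubicDesigns`** (strategist s1's typed statement, `Ideas/cubic-designs.md`, verbatim): for every `η > 0` an
STPP family (`IsSTPP`, CKSU Def. 5.1) of `L` blocks of the single long shape `(n, n, n³)`, `n ≥ 2`, in a finite abelian
group of order `≤ L·n^{4+η}`. -/
def CubicDesigns : Prop :=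
  ∀ η : ℝ, 0 < η → ∃ (H : Type) (_ : AddCommGroup H) (_ : Fintype H) (L n : ℕ) (A B C : Fin L → Finset H),
    IsSTPP A B C ∧ (∀ i, (A i).card = n ∧ (B i).card = n ∧ (C i).card = n ^ 3) ∧ 2 ≤ n ∧
      (Fintype.card H : ℝ) ≤ L * (n : ℝ) ^ ((4 : ℝ) + η)

/-! ## Registered stubs (the only `sorry`s of the line) -/

/-- **stub_skewUSP** (OPEN, load-bearing — C⁺): skew-(1,1,3) local strong USPs reach the cap.  Why plausibly true /
why it might fail: it is the class-(1,1,3)/5 member of the CKSU strong-USP capacity family `U_ℓ` (class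
`(1,1,ℓ−2)/ℓ` at the cap `h(1/ℓ)`; `U_ℓ ⟹ ω(1,1,ℓ−2) = ℓ−1`); `U₃` (balanced) is FALSE (BCCGNSU 2017 §1 via Thm B),
but Thm B is silent for `ℓ = 5` (needs `ε₅ > 0.1149` even symmetrised, has `0.0708`), no other upper-bound technique for 3-uniform
directed Sperner capacity within a type is in print, and the sibling skew class `(3,1,3)/7` resisted a standing
disprover (Cruxes/SkewLocalStrongUSP/Disproof.lean: "genuine open capacity question").  Size XL. -/
theorem stub_skewUSP : QuinticSkewUSP := by
  sorry

/-- **stub_uspToDesigns** (PROVABLE NOW, size M): Thm 33 at `ℓ = 5` plus counting.  Given `η > 0` put `δ := η`,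
take `m ≥ m₀ ≥ 1` large with `(5m+1)·2^{ηm} ≤ 4^{ηm}·…` (precisely `(5m+1)·2^{δ m} ≤ (4^m)^η`, true for `m` large since
`4^η > 2^δ` fails — so take `δ := η/2`), index `U` by `Fin |U|`, apply `CohnKleinbergSzegedyUmans2005_thm33_holds 5`,
count `|A_u| = |B_u| = 4^m`, `|C_u| = 4^{3m} = (4^m)^3` (`card_uspA/B/C`), and bound
`|H| = 5^{5m} = Σ_j C(5m,j)·4^{5m−j} ≤ (5m+1)·C(5m,m)·4^{4m}` (the `j = m` term is the mode) `≤ |U|·(4^m)^{4+η}`.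
Template: `uspToBounded_proof` (Theorems/ThinBlockAlphaUSPToBounded.lean). -/
theorem stub_uspToDesigns : QuinticSkewUSP → CubicDesigns := by
  sorry

/-- **stub_designsCertify** (PROVABLE NOW, size M): a cubic design family certifies `ω(1,1,3) ≤ 4`.
`R(⊕_{i<L} ⟨n,n,n³⟩) ≤ |H|` (`tensorRank_matMulDirectSum_le_card_of_isSTPP`), `R(⟨L⟩ ⊗ ⟨n,n,n³⟩) ≤ R(⊕)`
(`tensorRank_multiple_le_kroneckerPow_matMulDirectSum` with `N = 1`, plus `R(t^{⊗1})`-bookkeeping),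
`L·n^{ω(1,1,3)} ≤ R̃(⟨L⟩ ⊗ ⟨n^1,n^1,n^3⟩) ≤ R(…)` (`advxxz2025_thm32`, `asymptoticRank_le_tensorRank_pow_one`), hence
`n^{ω(1,1,3)} ≤ n^{4+η}` with `n ≥ 2`, so `ω(1,1,3) ≤ 4 + η` for every `η > 0`. -/
theorem stub_designsCertify : CubicDesigns → omegaRect ℂ 1 1 3 ≤ 4 := by
  sorry

/-! ## Glue (real proofs): the dictionary `ω(1,1,3) ≤ 4 ⟹ crux` (as in `Lines/birth.lean`) -/

/-- The admissible exponents of `ω(1,1,3)` are exactly the `β` with `R(⟨n,n,n³⟩) = O(n^β)` (the crux's rank form). -/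
theorem mem_rectAdmissibleExponents_113_iff (β : ℝ) :
    β ∈ rectAdmissibleExponents ℂ 1 1 3 ↔
      (fun n : ℕ => (tensorRank (matMulTensor ℂ n n (n ^ 3)) : ℝ)) =O[atTop]
        (fun n : ℕ => (n : ℝ) ^ β) := by
  have hfun : (fun n : ℕ =>
      (tensorRank (matMulTensor ℂ (rectDim n 1) (rectDim n 1) (rectDim n 3)) : ℝ)) =
      fun n : ℕ => (tensorRank (matMulTensor ℂ n n (n ^ 3)) : ℝ) := by
    funext n
    have h3 : rectDim n 3 = n ^ 3 := by
      rw [show (3 : ℝ) = ((3 : ℕ) : ℝ) by norm_num]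
      exact rectDim_natCast n 3
    rw [tensorRank_matMulTensor_congr ℂ (rectDim_one n) (rectDim_one n) h3]
  simp only [rectAdmissibleExponents, Set.mem_setOf_eq, hfun]

/-- DICTIONARY: `ω(1,1,3) ≤ 4 ⟹` the crux's rank form (the BODY of `CubicAmortisation`; `Negative.crux_iff` is
`Iff.rfl`).  Uses `0 < ε` (cf. `cubicAmortisation_false_without_pos`). -/
theorem rankBound_of_omegaRect_le (h : omegaRect ℂ 1 1 3 ≤ 4) :
    ∀ ε : ℝ, 0 < ε → (fun n : ℕ => (tensorRank (matMulTensor ℂ n n (n ^ 3)) : ℝ)) =O[atTop]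
      (fun n : ℕ => (n : ℝ) ^ ((4 : ℝ) + ε)) := by
  intro ε hε
  obtain ⟨β, hβ, hlt⟩ := Real.lt_sInf_add_pos (rectAdmissibleExponents_nonempty ℂ 1 1 3) hε
  have hle : β ≤ 4 + ε := by
    have hinf : sInf (rectAdmissibleExponents ℂ 1 1 3) = omegaRect ℂ 1 1 3 := rfl
    linarith
  exact (mem_rectAdmissibleExponents_113_iff _).1 (mem_rectAdmissibleExponents_of_le hβ hle)

/-! ## Composition -/

/-- COMPOSITION WITH THE STUB STATEMENTS AS HYPOTHESES (sorry-free): C⁺, the design transfer and the certificate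
give the crux's rank form (the BODY of `CubicAmortisation`; same shape as `Birth.rankBound_of_parts`). -/
theorem rankBound_of_stubs (h₁ : QuinticSkewUSP) (h₂ : QuinticSkewUSP → CubicDesigns)
    (h₃ : CubicDesigns → omegaRect ℂ 1 1 3 ≤ 4) :
    ∀ ε : ℝ, 0 < ε → (fun n : ℕ => (tensorRank (matMulTensor ℂ n n (n ^ 3)) : ℝ)) =O[atTop]
      (fun n : ℕ => (n : ℝ) ^ ((4 : ℝ) + ε)) :=
  rankBound_of_omegaRect_le (h₃ (h₂ h₁))

/-- THE SKELETON THEOREM — the crux BY NAME from the three registered stubs (the only theorem of the file whose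
conclusion is literally the route decl). -/
theorem CubicAmortisation_of : CubicAmortisation :=
  rankBound_of_stubs stub_skewUSP stub_uspToDesigns stub_designsCertify

/-! ## Honesty checks (sorry-free) -/

/-- Degenerate instance of the C⁺ matrix: `m = 0` (the empty row) satisfies it for every `δ`, so the closure
`∀ m₀ ∃ m ≥ m₀` is what keeps `QuinticSkewUSP` honest (same guard as the sibling's `cruxAt_zero`). -/
theorem quinticMatrix_zero (δ : ℝ) :
    ∃ U : Finset (Fin (5 * 0) → Fin 3),
      (∀ u ∈ U, ∀ v ∈ U, ∀ w ∈ U, (u ≠ v ∨ v ≠ w) →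
        ∃ i, (u i, v i, w i) ∈ localStrongUSPPatterns) ∧
      (∀ u ∈ U, (univ.filter fun i => u i = 0).card = 0 ∧ (univ.filter fun i => u i = 1).card = 0) ∧
      ((5 * 0).choose 0 : ℝ) ≤ (2 : ℝ) ^ (δ * 0) * U.card := by
  refine ⟨{fun i => i.elim0}, ?_, ?_, ?_⟩
  · intro u hu v hv w hw hne
    simp only [Finset.mem_singleton] at hu hv hw
    subst hu; subst hv; subst hw
    simp at hne
  · intro u _
    simp
  · simp

/-! FIRST RUNG: see `Lines/skew_usp_rung.lean` (the width-10 CKSU Prop. 11 member in the class (2,2,6) is a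
local strong USP of 10 rows — `native_decide`; kept out of the skeleton so that it elaborates in seconds). -/

end Summit.MatrixMultiplication.MatrixMultiplication.Cruxes.CubicAmortisation.SkewUSP

end
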